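import Mathlib.Analysis.Normed.Module.Convex
import Mathlib.Analysis.Convex.PathConnected
import Mathlib.Data.Nat.Find
import Literature.Probability.LatticeModels.LatticeInterface
import HarnessLib

/-!
# The dyadic clock of a polyline: which segment is occupied at a given time

Deterministic bookkeeping for the piecewise-linear curves `LatticeModels.polylineFrom a l` /
`LatticeModels.polyline` / `SimpleGraph.Walk.toCurve` of `LatticeInterface.lean`, whose
parametrisation is the DYADIC one produced by iterated `Path.trans` (segment `i` is run during
`[1 - 2^{-i}, 1 - 2^{-(i+1)}]`, constant tail after `1 - 2^{-n}`). Used by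
`PolylineShellTraversals.lean` (polyline traversals of a shell versus vertex traversals,
Aizenman–Burchard 1999 §3.a) and available to every lattice-curve argument that needs to pass from
parameter times to vertex indices monotonically.

* `dyadicTime i = 1 - 2^{-i} ∈ [0, 1]`, strictly increasing, `< 1`, with
  `2 · dyadicTime (i+1) - 1 = dyadicTime i` (the time change of the second half of `Path.trans`);
* `polylineFrom_apply_mem_segment` — during `[dyadicTime i, dyadicTime (i+1)]` (`i < l.length`) the
  polyline lies on the segment between the `i`-th and `(i+1)`-st points of `a :: l`;
  `polylineFrom_apply_of_le` — after `dyadicTime l.length` it rests at the last point;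
  `polylineFrom_apply_dyadicTime` — the `i`-th point is reached at time `dyadicTime i`;
* `segIdx n s` — the occupied segment index (largest `i ≤ n` with `dyadicTime i ≤ s`,
  `Nat.findGreatest`): `≤ n`, bracketing (`dyadicTime_segIdx_le`, `lt_dyadicTime_segIdx_succ`),
  monotone in `s` (`segIdx_mono`), and the position lemmas
  `polylineFrom_apply_mem_segment_segIdx`, `polylineFrom_apply_of_segIdx_eq`;
* `dist_le_of_mem_segment` — two points of a segment are no further apart than its endpoints
  (`convexHull_diam`).

Sources: folklore (the parametrisation is Mathlib's `Path.trans`; cf. Camia–Newman 2007 §2 for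
lattice paths as polygonal curves, as cited in `LatticeInterface.lean`). Mathlib:
`Path.trans_apply`, `Path.segment`, `Path.range_segment`, `convexHull_diam`, `Nat.findGreatest`.
No measures, no lattices here.
-/


open Set Metric
open scoped unitInterval
open Literature.Probability.LatticeModels (polylineFrom polyline)

noncomputable section

namespace Literature.Probability.RandomPlanarGeometry

/-! ### The dyadic clock of `polylineFrom` -/

/-- The **dyadic times** `1 - 2^{-i}` of the parametrisation of `polylineFrom a l` by iterated
`Path.trans`: the `i`-th vertex of `a :: l` is reached at time `dyadicTime i` (`i ≤ l.length`).
[folklore] -/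
def dyadicTime (i : ℕ) : I :=
  ⟨1 - (1 / 2 : ℝ) ^ i, by
    constructor
    · have : (1 / 2 : ℝ) ^ i ≤ 1 := pow_le_one₀ (by norm_num) (by norm_num)
      linarith
    · have : (0 : ℝ) ≤ (1 / 2 : ℝ) ^ i := by positivity
      linarith⟩

/-- `dyadicTime i = 1 - 2^{-i}` in coordinates. [folklore] -/
theorem coe_dyadicTime (i : ℕ) : (dyadicTime i : ℝ) = 1 - (1 / 2 : ℝ) ^ i := rfl

/-- `dyadicTime 0 = 0`. [folklore] -/
@[simp] theorem dyadicTime_zero : dyadicTime 0 = 0 := Subtype.ext (by simp [coe_dyadicTime])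

/-- `dyadicTime 1 = 1/2`. [folklore] -/
theorem coe_dyadicTime_one : (dyadicTime 1 : ℝ) = 1 / 2 := by norm_num [coe_dyadicTime]

/-- The dyadic times increase strictly. [folklore] -/
theorem dyadicTime_strictMono : StrictMono dyadicTime := by
  intro i j hij
  change (1 : ℝ) - (1 / 2) ^ i < 1 - (1 / 2) ^ j
  have : (1 / 2 : ℝ) ^ j < (1 / 2) ^ i := pow_lt_pow_right_of_lt_one₀ (by norm_num) (by norm_num) hij
  linarith

/-- The dyadic times are monotone. [folklore] -/
theorem dyadicTime_mono : Monotone dyadicTime := dyadicTime_strictMono.monotone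

/-- Every dyadic time is `< 1`. [folklore] -/
theorem coe_dyadicTime_lt_one (i : ℕ) : (dyadicTime i : ℝ) < 1 := by
  have : (0 : ℝ) < (1 / 2 : ℝ) ^ i := by positivity
  simp only [coe_dyadicTime]
  linarith

/-- The time change of the second half of `Path.trans` shifts the dyadic clock by one:
`2 · dyadicTime (i+1) - 1 = dyadicTime i`. [folklore] -/
theorem two_mul_dyadicTime_succ_sub_one (i : ℕ) :
    2 * (dyadicTime (i + 1) : ℝ) - 1 = dyadicTime i := by
  simp only [coe_dyadicTime, pow_succ]
  ring

/-- `1/2 ≤ dyadicTime (i+1)`. [folklore] -/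
theorem half_le_coe_dyadicTime_succ (i : ℕ) : 1 / 2 ≤ (dyadicTime (i + 1) : ℝ) := by
  have h := dyadicTime_mono (Nat.succ_le_succ (Nat.zero_le i))
  have h' : (dyadicTime 1 : ℝ) ≤ dyadicTime (i + 1) := h
  rwa [coe_dyadicTime_one] at h'

/-- If `dyadicTime (i+1) ≤ 1/2` then `i = 0`. [folklore] -/
theorem eq_zero_of_dyadicTime_succ_le_half {i : ℕ} (h : (dyadicTime (i + 1) : ℝ) ≤ 1 / 2) : i = 0 := by
  by_contra hi
  have h2 : (dyadicTime 1 : ℝ) < dyadicTime (i + 1) :=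
    dyadicTime_strictMono (by omega : 1 < i + 1)
  rw [coe_dyadicTime_one] at h2
  linarith

/-! ### Where the polyline is at a given time -/

section Polyline

variable {V : Type*} [NormedAddCommGroup V] [NormedSpace ℝ V]

/-- The second-half time `2s - 1` of `Path.trans`, as a point of `[0, 1]`, for `s ≥ 1/2`. [folklore] -/
def transHalfR (s : I) (h : ¬ (s : ℝ) ≤ 1 / 2) : I :=
  ⟨2 * s - 1, unitInterval.two_mul_sub_one_mem_iff.2 ⟨(not_le.1 h).le, s.2.2⟩⟩

/-- `transHalfR` in coordinates. [folklore] -/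
@[simp] theorem coe_transHalfR (s : I) (h : ¬ (s : ℝ) ≤ 1 / 2) : (transHalfR s h : ℝ) = 2 * s - 1 := rfl

/-- Unfolding `polylineFrom a (b :: l)` at a time of the second half. [folklore] -/
theorem polylineFrom_cons_apply_of_not_le (a b : V) (l : List V) (s : I) (h : ¬ (s : ℝ) ≤ 1 / 2) :
    (polylineFrom a (b :: l)).2 s = (polylineFrom b l).2 (transHalfR s h) := by
  rw [LatticeModels.polylineFrom_cons]
  change ((Path.segment a b).trans (polylineFrom b l).2) s = _
  rw [Path.trans_apply, dif_neg h]
  rfl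

/-- Unfolding `polylineFrom a (b :: l)` at a time of the first half: a point of the first segment.
[folklore] -/
theorem polylineFrom_cons_apply_mem_segment_of_le (a b : V) (l : List V) (s : I)
    (h : (s : ℝ) ≤ 1 / 2) : (polylineFrom a (b :: l)).2 s ∈ segment ℝ a b := by
  rw [LatticeModels.polylineFrom_cons]
  change ((Path.segment a b).trans (polylineFrom b l).2) s ∈ _
  rw [Path.trans_apply, dif_pos h, ← Path.range_segment a b]
  exact mem_range_self _

/-- At time exactly `1/2` the polyline `polylineFrom a (b :: l)` is at `b`. [folklore] -/
theorem polylineFrom_cons_apply_of_eq_half (a b : V) (l : List V) (s : I) (h : (s : ℝ) = 1 / 2) :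
    (polylineFrom a (b :: l)).2 s = b := by
  rw [LatticeModels.polylineFrom_cons]
  change ((Path.segment a b).trans (polylineFrom b l).2) s = _
  rw [Path.trans_apply, dif_pos h.le]
  have h1 : (⟨2 * (s : ℝ), (unitInterval.mul_pos_mem_iff zero_lt_two).2 ⟨s.2.1, h.le⟩⟩ : I) = 1 :=
    Subtype.ext (by simp [h])
  rw [h1, Path.target]

/-- **The `i`-th segment is run during `[dyadicTime i, dyadicTime (i+1)]`**: at such a time the
polyline `polylineFrom a l` lies on the segment from the `i`-th to the `(i+1)`-st point of
`a :: l` (`i < l.length`). [folklore] -/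
theorem polylineFrom_apply_mem_segment (a : V) (l : List V) {i : ℕ} (hi : i < l.length) {s : I}
    (h1 : (dyadicTime i : ℝ) ≤ s) (h2 : (s : ℝ) ≤ dyadicTime (i + 1)) :
    (polylineFrom a l).2 s ∈
      segment ℝ ((a :: l)[i]'(Nat.lt_succ_of_lt hi)) ((a :: l)[i + 1]'(Nat.succ_lt_succ hi)) := by
  induction l generalizing a i s with
  | nil => simp at hi
  | cons b l ih =>
    cases i with
    | zero =>
      have h2' : (s : ℝ) ≤ dyadicTime 1 := h2
      have hs : (s : ℝ) ≤ 1 / 2 := by rwa [coe_dyadicTime_one] at h2'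
      simpa using polylineFrom_cons_apply_mem_segment_of_le a b l s hs
    | succ j =>
      by_cases hs : (s : ℝ) ≤ 1 / 2
      · -- then `s = 1/2`, `j = 0`, and the polyline is at `b`, the left end of the next segment
        have hj : j = 0 := eq_zero_of_dyadicTime_succ_le_half (h1.trans hs)
        subst hj
        have h1' : ((dyadicTime 1 : I) : ℝ) ≤ s := h1
        have hs' : (s : ℝ) = 1 / 2 := le_antisymm hs (by rwa [coe_dyadicTime_one] at h1')
        rw [polylineFrom_cons_apply_of_eq_half a b l s hs']
        have hl : 0 < l.length := by simpa using hi
        obtain ⟨c, l', rfl⟩ := List.exists_cons_of_length_pos hl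
        simpa using left_mem_segment ℝ b c
      · rw [polylineFrom_cons_apply_of_not_le a b l s hs]
        have hj : j < l.length := by simpa using hi
        have h1' : (dyadicTime j : ℝ) ≤ transHalfR s hs := by
          rw [coe_transHalfR, ← two_mul_dyadicTime_succ_sub_one]
          linarith
        have h2' : ((transHalfR s hs : I) : ℝ) ≤ dyadicTime (j + 1) := by
          rw [coe_transHalfR, ← two_mul_dyadicTime_succ_sub_one]
          linarith
        simpa using ih b hj h1' h2'

/-- **After `dyadicTime l.length` the polyline rests at the last point.** [folklore] -/
theorem polylineFrom_apply_of_le (a : V) (l : List V) {s : I} (h : (dyadicTime l.length : ℝ) ≤ s) :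
    (polylineFrom a l).2 s = (a :: l).getLast (List.cons_ne_nil a l) := by
  induction l generalizing a s with
  | nil =>
    change (Path.refl a) s = _
    simp
  | cons b l ih =>
    have h' : (dyadicTime (l.length + 1) : ℝ) ≤ s := h
    by_cases hs : (s : ℝ) ≤ 1 / 2
    · have hl : l.length = 0 := eq_zero_of_dyadicTime_succ_le_half (h'.trans hs)
      have hl' : l = [] := List.length_eq_zero_iff.1 hl
      subst hl'
      have hs' : (s : ℝ) = 1 / 2 :=
        le_antisymm hs ((half_le_coe_dyadicTime_succ _).trans h')
      rw [polylineFrom_cons_apply_of_eq_half a b [] s hs']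
      simp
    · rw [polylineFrom_cons_apply_of_not_le a b l s hs, List.getLast_cons (List.cons_ne_nil b l)]
      refine ih b ?_
      rw [coe_transHalfR, ← two_mul_dyadicTime_succ_sub_one]
      linarith

/-- **The `i`-th point is reached at time `dyadicTime i`** (`i ≤ l.length`). [folklore] -/
theorem polylineFrom_apply_dyadicTime (a : V) (l : List V) {i : ℕ} (hi : i ≤ l.length) :
    (polylineFrom a l).2 (dyadicTime i) = (a :: l)[i]'(Nat.lt_succ_of_le hi) := by
  induction l generalizing a i with
  | nil =>
    have hi0 : i = 0 := by simpa using hi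
    subst hi0
    change (Path.refl a) _ = _
    simp
  | cons b l ih =>
    cases i with
    | zero =>
      rw [dyadicTime_zero, Path.source]
      rfl
    | succ j =>
      by_cases hs : ((dyadicTime (j + 1) : I) : ℝ) ≤ 1 / 2
      · have hj : j = 0 := eq_zero_of_dyadicTime_succ_le_half hs
        subst hj
        rw [polylineFrom_cons_apply_of_eq_half a b l _ coe_dyadicTime_one]
        simp
      · rw [polylineFrom_cons_apply_of_not_le a b l _ hs]
        have heq : transHalfR (dyadicTime (j + 1)) hs = dyadicTime j :=
          Subtype.ext (by rw [coe_transHalfR, two_mul_dyadicTime_succ_sub_one])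
        rw [heq]
        have hj : j ≤ l.length := by simpa using hi
        simpa using ih b hj

/-! ### The index of the segment occupied at a given time -/

open scoped Classical in
/-- The index of the segment of an `n`-segment polyline occupied at time `s`: the largest `i ≤ n`
with `dyadicTime i ≤ s` (value `n` on the constant tail). [folklore] -/
def segIdx (n : ℕ) (s : I) : ℕ := Nat.findGreatest (fun i => (dyadicTime i : ℝ) ≤ s) n

/-- `segIdx n s ≤ n`. [folklore] -/
theorem segIdx_le (n : ℕ) (s : I) : segIdx n s ≤ n := by
  classical
  exact Nat.findGreatest_le n

/-- The occupied segment has started: `dyadicTime (segIdx n s) ≤ s`. [folklore] -/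
theorem dyadicTime_segIdx_le (n : ℕ) (s : I) : (dyadicTime (segIdx n s) : ℝ) ≤ s := by
  classical
  exact Nat.findGreatest_spec (P := fun i => (dyadicTime i : ℝ) ≤ s) (Nat.zero_le n)
    (by simpa using s.2.1)

/-- The occupied segment has not ended: `s < dyadicTime (segIdx n s + 1)` unless on the tail.
[folklore] -/
theorem lt_dyadicTime_segIdx_succ {n : ℕ} {s : I} (h : segIdx n s < n) :
    (s : ℝ) < dyadicTime (segIdx n s + 1) := by
  classical
  have := Nat.findGreatest_is_greatest (P := fun i => (dyadicTime i : ℝ) ≤ s) (Nat.lt_succ_self _)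
    (Nat.succ_le_of_lt h)
  exact not_le.1 this

/-- A dyadic time that has passed is at most the occupied index. [folklore] -/
theorem le_segIdx {n i : ℕ} {s : I} (hi : i ≤ n) (h : (dyadicTime i : ℝ) ≤ s) : i ≤ segIdx n s := by
  classical
  exact Nat.le_findGreatest (P := fun i => (dyadicTime i : ℝ) ≤ s) hi h

/-- A dyadic time not yet reached exceeds the occupied index. [folklore] -/
theorem segIdx_lt_of_lt {n i : ℕ} {s : I} (h : (s : ℝ) < dyadicTime i) : segIdx n s < i := by
  by_contra hle
  have h1 := dyadicTime_segIdx_le n s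
  have h2 : (dyadicTime i : ℝ) ≤ dyadicTime (segIdx n s) := dyadicTime_mono (not_lt.1 hle)
  linarith

/-- The occupied index is monotone in time. [folklore] -/
theorem segIdx_mono (n : ℕ) {s s' : I} (h : s ≤ s') : segIdx n s ≤ segIdx n s' := by
  classical
  exact Nat.findGreatest_mono_left (fun i (hi : (dyadicTime i : ℝ) ≤ s) => hi.trans h) n

/-- Off the tail, the polyline lies on the occupied segment. [folklore] -/
theorem polylineFrom_apply_mem_segment_segIdx (a : V) (l : List V) (s : I)
    (h : segIdx l.length s < l.length) :
    (polylineFrom a l).2 s ∈ segment ℝ ((a :: l)[segIdx l.length s]'(Nat.lt_succ_of_lt h))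
      ((a :: l)[segIdx l.length s + 1]'(Nat.succ_lt_succ h)) :=
  polylineFrom_apply_mem_segment a l h (dyadicTime_segIdx_le _ _) (lt_dyadicTime_segIdx_succ h).le

/-- On the tail (`segIdx = l.length`), the polyline is at the last point, which is the point of
index `l.length` of `a :: l`. [folklore] -/
theorem polylineFrom_apply_of_segIdx_eq (a : V) (l : List V) (s : I)
    (h : segIdx l.length s = l.length) :
    (polylineFrom a l).2 s = (a :: l)[l.length]'(Nat.lt_succ_self _) := by
  have hs : (dyadicTime l.length : ℝ) ≤ s := by rw [← h]; exact dyadicTime_segIdx_le _ _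
  rw [polylineFrom_apply_of_le a l hs, List.getLast_eq_getElem]
  simp

/-! ### Distances along short segments -/

/-- Two points of a segment are no further apart than its endpoints. [folklore] -/
theorem dist_le_of_mem_segment {v w p q : V} (hp : p ∈ segment ℝ v w) (hq : q ∈ segment ℝ v w) :
    dist p q ≤ dist v w := by
  have hb : Bornology.IsBounded (segment ℝ v w) := by
    rw [← convexHull_pair]
    exact (isBounded_convexHull).2 (Set.toFinite _).isBounded
  calc dist p q ≤ diam (segment ℝ v w) := dist_le_diam_of_mem hb hp hq
    _ = diam ({v, w} : Set V) := by rw [← convexHull_pair, convexHull_diam]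
    _ = dist v w := diam_pair

/-- A point of a segment is within the segment's length of its right endpoint. [folklore] -/
theorem dist_right_le_of_mem_segment {v w p : V} (hp : p ∈ segment ℝ v w) : dist p w ≤ dist v w :=
  dist_le_of_mem_segment hp (right_mem_segment ℝ v w)

/-- A point of a segment is within the segment's length of its left endpoint. [folklore] -/
theorem dist_left_le_of_mem_segment {v w p : V} (hp : p ∈ segment ℝ v w) : dist p v ≤ dist v w :=
  dist_le_of_mem_segment hp (left_mem_segment ℝ v w)

end Polyline

end Literature.Probability.RandomPlanarGeometry

end
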